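import Summits.Ventures.HSemireg.S4BridgeSplitPointLadder
import Literature.AlgebraicGeometry.HodgeTheory.WeilClassesDescendingOfLefschetzOneOne
import Literature.AlgebraicGeometry.HodgeTheory.WeilClassesDescendingProofs
import Literature.AlgebraicGeometry.HodgeTheory.WeilClassesRationalPlane
import Literature.AlgebraicGeometry.HodgeTheory.LefschetzOneOneHolds
import HarnessLib

/-!
# Venture HSemireg — S4-PUSH bridge (B2), LADDER form AS PRINTED by Schoen: the upper rung is CLASS-AGNOSTIC —
# ONE component `(n+1, K, f)` of ANY class `f` (`sign f = (-1)ⁿ⁺¹`) decides EVERY component `(n, K, δ)`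

HONEST FRAMING. Bridge-typing file of the computation cell `pub-hsemireg` (track «S4-PUSH» (iii), seat s4-bridge-2;
third companion of `S4BridgeSplitPoint.lean` (B2, CONTAINMENT reading) and `S4BridgeSplitPointLadder.lean` ((B2-L) ladder
product point into the SPLIT component, (B2-L′) descent from the SPLIT component); typing note
`s4push/B2-TYPING-s4-bridge-2.md`). THEOREMS ONLY (0 sorry; no definition; no named fact consumed — Lefschetz `(1,1)` and
Schoen's transfer are PROVED tree theorems). It answers the theory seat's AS-PRINTED precision (cell bus l.10456 (ii)):
Schoen's Proposition is stated for an upper component of ARBITRARY class `f` with `sign f = -1`, not only the split one;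
Markman's §11.5 Step 2 sentence and the tree's (B2-L′) `weilClassesComponent_of_split_component_succ` are its case
`f = [(-1)ⁿ⁺¹]`. Nothing here bears on any OPEN case of the Hodge conjecture (every statement about Weil classes below is
an IMPLICATION between the typed class targets `Ring2.Hypotheses.WeilClassesComponent`, which are OPEN); no object of
the cell is certified; HC / HC_CM / HC_AV are NOT proved.

## AS PRINTED — [Schoen1998HodgeWeilAddendum] C. Schoen, *Addendum to: Hodge classes on self-products of a variety with
## an automorphism*, Compositio Math. 114 (1998) 329–336 (REFEREED; held text `paper:doi-10-1023-a-1000566205021`,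
## statement p. 332 = page file p0004, proof pp. 332–333 = page files p0004–p0005; the paper numbers PARAGRAPHS, «10. PROPOSITION» = ¶10;
## Greek letters restored from context — the held text layer drops them; ONE letter `β` for Schoen's alternating forms, as in `s4push/BRIDGE-LIT-ASPRINTED.md` §B2-R)

«10. PROPOSITION. Let `(A, β_A)` be a Weil type Abelian four-fold with polarization invariant `(2, f_A)` for some
`f_A ∈ ℚ*/N_ℚ^K K*` with `sign(f_A) = 1`. Fix `f ∈ ℚ*/N_ℚ^K K*` with `sign(f) = -1` and a Weil pair of rank `6`,
`(V_ℤ, β)`, with invariant `(3, f)`. Suppose that for each Abelian variety in the associated 'universal' family, the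
Weil cohomology is generated by classes of codimension `3` algebraic cycles. Then the Weil cohomology of `A`, `W_A`, is
generated by classes of codimension `2` algebraic cycles.
Proof. Choose `f′ ∈ ℚ*/N_ℚ^K K*` such that `f′ f_A = f`. By 7 there exists a Weil pair of rank `2`, `(V′_ℤ, β′)` with
invariant `(1, f′)`. The choice of an admissible complex structure `J′ ∈ End(V′_ℝ)` gives rise to a Weil type Abelian
surface `A′`, whose Weil cohomology, `W_{A′}`, has Hodge type `(1,1)`. `W_{A′}` is generated by cohomology classes of
divisors. The Weil pair associated to the product `A × A′` is `(H₁(A;ℤ) ⊕ V′_ℤ, β_A ⊕ β′)`. By 7 there is an isometry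
of Hermitian inner product spaces […] which leads to an isogeny of Abelian varieties of Weil type
`A × A′ → (V_ℝ/V_ℤ, J)` […]. It follows from 6 and the hypotheses of the proposition that the Weil cohomology,
`W_{A×A′}`, is generated by cohomology classes of algebraic cycles. […]» [cite: Schoen1998HodgeWeilAddendum, 10 (Proposition), p. 332]

## The typed statements (component data explicit: `(n, d, δ)` below, `(n+1, d, f)` above, the partner in `(1, d, f·δ)`)

Conventions as in `S4BridgeSplitPoint.lean`: `K = K_d = ℚ(√-d)`; the typed component `(n, d, δ)` consists of the
polarized triples `(A, φ, h_K = d·e^*a + φ^*e^*a)` with `VanGeemen1994.HasWeilDiscriminantNondeg A φ n d h_K δ`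
(Schoen's «invariant `(b, f)`» with `b = n`, `f = δ`: his `b` is the negative index of `φ`, ¶2, and `sign f = (-1)^b`);
`Ring2.AbelianAll.weilSign d : ℚˣ/Nm(K_dˣ) →* ℤˣ` is Schoen's `sign`.

* `exists_cmProductPoint_partner_prod_mem_component` — **Schoen's partner and product, component data explicit, for an
  ARBITRARY upper class.** For a member `(A, φ, h_K)` of Weil type `(n, d)` of `(n, d, δ)` and every `f` with
  `sign f = (-1)ⁿ⁺¹`: a CM elliptic curve `(E₀, ψ₀)`, a partner Weil SURFACE `(S, ψ, h_S)` which is a product point over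
  `E₀` (`IsCMProductPoint`), lying in the component `(1, d, f·δ)` (Schoen's `f′` with `f′ f_A = f`; `sign f′ = -1`), and
  a `K`-symmetrised hyperplane class on `(A × S, φ × ψ)` of class `f` — the product lies in `(n+1, d, f)`. (The tree's
  (B2-L) `exists_cmSquare_partner_prod_isSplitWeilType` is the case `f = [(-1)ⁿ⁺¹]`.)
* `weilClassesComponent_of_component_succ` — **the Proposition, component currency, all `n ≥ 1`.** If
  `sign f = (-1)ⁿ⁺¹` and every rational `(n+1,n+1)` Weil class of every member of `(n+1, d, f)` is algebraic
  (`WeilClassesComponent (n+1) d f`), then `WeilClassesComponent n d δ` for EVERY `δ`.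
* `weilClassesComponent_two_of_three` (`(n, n+1) = (2, 3)`: fourfolds from ONE sixfold class, the printed case) and
  `weilClassesComponent_three_of_four` (`(3, 4)`: every Weil SIXFOLD component of `K_d` from ONE eightfold component of
  any class `f` with `sign f = 1` — the instance the theory seat named for the S4 chain).
* `weilAlgebraicAll_of_component_succ` — component-free form (`WeilAlgebraicAll n d`: every rational `(n,n)` Weil class
  on EVERY `(A, φ)` with `φ ≫ φ = -d`, polarisation not in the data), since every `(A, φ)` has SOME class `δ`
  (`VanGeemen1994.exists_hasWeilDiscriminantNondeg`, Lemma 5.2 (1)–(3), a tree theorem).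
* `weilClassesByComponent_of_components_succ` — uniform: one upper component per `(n+1, d)`, `n ≥ 2`, gives
  `Ring2.Hypotheses.WeilClassesByComponent`; `weilClassesComponent_of_split_component_succ'` — (B2-L′) recovered as the
  instance `f = [(-1)ⁿ⁺¹]`, now for all `n ≥ 1`.

## Kernel route (all inputs are tree THEOREMS; no `sorry`, no named fact)

sign of the member's class (`Ring2.AbelianAll.weilSign_eq_of_hasWeilDiscriminantNondeg`, Lemma 5.2 (4); Weil type of
`(A, φ)` from a non-zero rational `(n,n)` Weil class, `HodgeTheory.isWeilType_of_weilClass_ne_zero`, Deligne–Milne 4.4 —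
for the zero class there is nothing to prove) ⟶ partner = (B2) `splitPointInEachDiscriminantComponent_holds` at rank `1` in
the class `f·δ` ⟶ product class `δ·(f·δ) = f` by ring 2's multiplication law
`Ring2.AbelianAll.exists_ksymm_hasWeilDiscriminantNondeg_prod` («det H is multiplicative», Schoen's
`(H₁(A;ℤ) ⊕ V′_ℤ, β_A ⊕ β′)`) and `δ² = 1` ⟶ the hypothesis AT THE PRODUCT (a member of `(n+1, d, f)`) ⟶ Schoen's transfer
`HodgeTheory.Schoen1998_weilClasses_algebraic_of_prod_surface_all_of_weilClass_algebraic` (PROVED: rational Weil projector,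
translated divisors, Gysin push-forward along `pr_A` — Schoen's `pr_{A*}(z · (A × D))`), whose input «`W_{A′}` is
generated by cohomology classes of divisors» is Lefschetz `(1,1)` on the partner surface
(`HodgeTheory.lefschetzOneOne_rational_holds`, PROVED) applied to a non-zero rational class `u = u₊ + u₋` of its Weil
plane (`exists_isRationalClass_ne_zero_mem_weilClassesOf`, `ne_zero_of_isRationalClass_add`).

## Readings NAMED (typed vs printed)

* HYPOTHESIS TYPED STRONGER ⟹ THEOREM TYPED WEAKER-OR-EQUAL: Schoen assumes algebraicity on the universal family of
  ONE Weil pair `(V_ℤ, β)` of invariant `(n+1, f)` and REACHES the product `A × A′` by an isogeny (¶¶6–7, Landherr);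
  the typed hypothesis `WeilClassesComponent (n+1) d f` quantifies over the whole typed CLASS `(n+1, d, f)` (every
  polarized triple with `det H = f`; several moduli components, pairwise isogenous by ¶6), which contains the polarized
  product itself — so the isogeny/reach step (¶¶6–7; on the tree side the NAMED fact `HodgeTheory.weilFamilyReach_similar`)
  is NOT needed and NOT used. Family ⟹ class is exactly that named reach fact; nothing here discharges it.
* PRINTED for `(n, n+1) = (2, 3)` and `K` any imaginary quadratic field; TYPED for all `n ≥ 1` (Schoen's proof is
  dimension-free; the tree's transfer is proved in every even dimension) — named, not silent.
* `sign(f_A) = 1` (printed) is automatic: a member of `(n, d, δ)` of Weil type has `sign δ = (-1)ⁿ`; for `δ` of the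
  wrong sign the component is EMPTY and the conclusion vacuous (so `δ` is unrestricted in the statements).
* The partner: printed = ANY member `A′` of the rank-2 family of invariant `(1, f′)` + «`W_{A′}` is generated by
  cohomology classes of divisors»; typed = the (B2) product point over `E₀ = ℂ/(ℤ + ℤ√-d)` in the class `f′ = f·δ`
  (a member of that class, which is all the proof uses) + Lefschetz `(1,1)` (tree theorem) — equal in strength.
* «Split point» = PRODUCT point; «component» = discriminant CLASS; «isogenous ≠ isomorphic»; polarisation and `K`-action
  in the data — referee protocol §3 (B2) traps (i)–(iv), as in the companion files.

References: [Schoen1998HodgeWeilAddendum] ¶¶2, 6, 7, 10 (Proposition, p. 332; proof pp. 332–333) ·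
[Markman2025SurveySecant] arXiv:2509.23403 (UNREFEREED preprint; published sibling [Markman2026ICMSecant], ICM 2026 Proc.) §11.5 Step 2 (p. 21) · [Markman2025SecantWeil] arXiv:2502.03415 v2
(UNREFEREED) Cor. 1.6.1, proof (p. 9) «[S2, Prop. 10]» · [vanGeemen1994HodgeAV] LNM 1594 4.14, Lemma 5.2, 5.3–5.8 ·
[VoisinHodgeI2002] Thm. 11.30 (Lefschetz `(1,1)`) · [Landherr1936HermitianForms].
-/

noncomputable section

open CategoryTheory MonoidalCategory AlgebraicGeometry
open Literature.AlgebraicGeometry Literature.AlgebraicGeometry.Motives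
open Literature.AlgebraicGeometry.Motives.SegreHyperplaneClass
open Literature.AlgebraicGeometry.HodgeTheory
open Literature.AlgebraicGeometry.VanGeemen1994
open Literature.AlgebraicTopology.SingularHomology
open Summit.HodgeConjecture.HodgeConjecture.Ring2.Hypotheses
open Summit.HodgeConjecture.HodgeConjecture.Ring2.AbelianAll
open Summit.HodgeConjecture.HodgeConjecture.Cruxes.HodgeAbelianVarieties.EStepSecantInduction

namespace Summit.Ventures.HSemireg

/-! ### §1 Sign bookkeeping: Schoen's `f′` with `f′ f_A = f` is a SURFACE class -/

/-- If `sign δ = (-1)ⁿ` (the member's class `f_A = δ`) and `sign f = (-1)ⁿ⁺¹` (the upper class) then the partner class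
`f′ = f·δ` has `sign f′ = -1 = (-1)¹`, the sign of the Weil SURFACE components (Schoen ¶2 «sign(f) = (-1)^b»; ¶10
«Choose `f′` … such that `f′ f_A = f`»; van Geemen 4.14). [cite: Schoen1998HodgeWeilAddendum, 10 (Proposition, proof), p. 332]
[cite: vanGeemen1994HodgeAV, 4.14 and Lemma 5.2 (4)] -/
theorem weilSign_mul_of_sign_succ {d n : ℕ} {δ f : weilNormResidueGroup d} (hδ : weilSign d δ = (-1) ^ n)
    (hf : weilSign d f = (-1) ^ (n + 1)) : weilSign d (f * δ) = (-1) ^ 1 := by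
  rw [map_mul, hf, hδ]
  -- `^` on `ℤˣ` elaborates through `Int.instUnitsPow` (definitionally the monoid power): split on `(-1)ⁿ = ±1`
  rcases Int.units_eq_one_or ((-1 : ℤˣ) ^ n) with h | h
  · rw [show ((-1 : ℤˣ) ^ (n + 1 : ℕ)) = (-1) ^ (n : ℕ) * (-1) from pow_succ _ _, h]; simp
  · rw [show ((-1 : ℤˣ) ^ (n + 1 : ℕ)) = (-1) ^ (n : ℕ) * (-1) from pow_succ _ _, h]; simp

/-- `δ · (f · δ) = f` in the `2`-torsion group `ℚˣ/Nm(K_dˣ)` (the product class: `f_A · f′ = f`).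
[cite: Schoen1998HodgeWeilAddendum, 10 (Proposition, proof), p. 332] [cite: vanGeemen1994HodgeAV, 4.14] -/
theorem mul_mul_self_cancel_right {d : ℕ} (δ f : weilNormResidueGroup d) : δ * (f * δ) = f := by
  rw [mul_comm f δ, mul_mul_self_cancel]

/-! ### §2 Schoen's partner surface and the product, component data explicit, for an ARBITRARY upper class `f` -/

/-- **The ladder product point into the component `(n+1, d, f)` of ANY class `f` with `sign f = (-1)ⁿ⁺¹`.** Let
`(A, φ)` be of Weil type `(n, d)` and let `h_K = d·e^*a + φ^*e^*a` have non-degenerate discriminant class `δ` (a member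
of `(n, d, δ)`; `sign δ = (-1)ⁿ` follows). Then for every class `f` with `sign f = (-1)ⁿ⁺¹` there are a CM elliptic
curve `(E₀, ψ₀)` (`dim E₀ = 1`, `ψ₀ ≫ ψ₀ = -d`), a PARTNER `(S, ψ, h_S)` — a product point over `E₀`
(`IsCMProductPoint E₀ ψ₀ S ψ`), a Weil-type SURFACE, in the component `(1, d, f·δ)` (Schoen's `f′`, `f′ f_A = f`) — and a
`K`-symmetrised hyperplane class on the PRODUCT `(A × S, φ × ψ)` of class `f`: the product lies in `(n+1, d, f)`. Schoen
¶10, proof: «Choose `f′` … such that `f′ f_A = f`. By 7 there exists a Weil pair of rank 2 … with invariant `(1, f′)` …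
a Weil type Abelian surface `A′` … The Weil pair associated to the product `A × A′` is `(H₁(A;ℤ) ⊕ V′_ℤ, β_A ⊕ β′)`»
(discriminants multiply: Markman §11.5 Step 2, Voisin Exp. 1248 Lemme 2.9); printed at `n = 2`, typed for all `n`.
Kernel: (B2) at rank `1` in the class `f·δ` + ring 2's multiplication law + `δ² = 1`.
[cite: Schoen1998HodgeWeilAddendum, 10 (Proposition, proof), pp. 332–333] [cite: Markman2025SurveySecant, §11.5 Step 2 (p. 21)]
[cite: vanGeemen1994HodgeAV, 4.14, Lemma 5.2 (3)–(4) and 5.3] -/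
theorem exists_cmProductPoint_partner_prod_mem_component {n d : ℕ} {A : AbelianVariety ℂ} {φ : A ⟶ A}
    (hW : IsWeilType A φ n d) (e : ProjectiveEmbedding A.X) {a : complexBetti (projectiveSpace e.n ℂ) 2}
    (ha : IsRationalClass a) (ha0 : a ≠ 0) {δ : weilNormResidueGroup d}
    (hδ : HasWeilDiscriminantNondeg A φ n d
      ((d : ℂ) • complexBetti.map e.ι 2 a + complexBetti.map φ.hom.hom.hom 2 (complexBetti.map e.ι 2 a)) δ)
    {f : weilNormResidueGroup d} (hf : weilSign d f = (-1) ^ (n + 1)) :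
    ∃ (E₀ : AbelianVariety ℂ) (ψ₀ : E₀ ⟶ E₀) (S : AbelianVariety ℂ) (ψ : S ⟶ S) (eS : ProjectiveEmbedding S.X)
      (aS : complexBetti (projectiveSpace eS.n ℂ) 2) (e' : ProjectiveEmbedding (A.prod S).X)
      (a' : complexBetti (projectiveSpace e'.n ℂ) 2),
      E₀.dim = 1 ∧ ψ₀ ≫ ψ₀ = -(d • 𝟙 E₀) ∧ IsCMProductPoint E₀ ψ₀ S ψ ∧ IsWeilType S ψ 1 d ∧
      IsRationalClass aS ∧ aS ≠ 0 ∧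
      HasWeilDiscriminantNondeg S ψ 1 d
        ((d : ℂ) • complexBetti.map eS.ι 2 aS + complexBetti.map ψ.hom.hom.hom 2 (complexBetti.map eS.ι 2 aS))
        (f * δ) ∧
      IsRationalClass a' ∧ a' ≠ 0 ∧
      HasWeilDiscriminantNondeg (A.prod S)
        (AbelianVariety.prodLift (AbelianVariety.fst A S ≫ φ) (AbelianVariety.snd A S ≫ ψ)) (n + 1) d
        ((d : ℂ) • complexBetti.map e'.ι 2 a' +
          complexBetti.map (AbelianVariety.prodLift (AbelianVariety.fst A S ≫ φ)
            (AbelianVariety.snd A S ≫ ψ)).hom.hom.hom 2 (complexBetti.map e'.ι 2 a'))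
        f := by
  -- the member's class has the right sign, so Schoen's `f′ = f·δ` is a surface class
  have hsgn : weilSign d δ = (-1) ^ n := weilSign_eq_of_hasWeilDiscriminantNondeg hW e ha ha0 hδ
  -- (B2) at rank 1: a CM product point in the component `(1, d, f·δ)`
  obtain ⟨E₀, ψ₀, S, ψ, eS, aS, hE, hψ, hP, hWS, haS, haS0, hNS⟩ :=
    splitPointInEachDiscriminantComponent_holds 1 d one_pos hW.d_pos _ (weilSign_mul_of_sign_succ hsgn hf)
  -- component multiplication law: `(n, δ) · (1, f·δ) ↦ (n + 1, f)`
  obtain ⟨e', a', ha', ha'0, hN'⟩ := exists_ksymm_hasWeilDiscriminantNondeg_prod hW.pos hWS.pos hW.dim_eq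
    hWS.dim_eq hW.d_pos hW.sq_eq hWS.sq_eq e ha ha0 eS haS haS0 hδ hNS
  rw [mul_mul_self_cancel_right] at hN'
  exact ⟨E₀, ψ₀, S, ψ, eS, aS, e', a', hE, hψ, hP, hWS, haS, haS0, hNS, ha', ha'0, hN'⟩

/-! ### §3 The Proposition in component currency: ONE upper component of ANY class decides every component below -/

/-- **Schoen's Proposition 10, component currency, all `n ≥ 1` — the upper rung is CLASS-AGNOSTIC.** Let `n ≥ 1`,
`d ≥ 1`, and let `f ∈ ℚˣ/Nm(K_dˣ)` have `sign f = (-1)ⁿ⁺¹`. IF every rational `(n+1,n+1)` Weil class of every member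
of the component `(n+1, d, f)` is algebraic (`Ring2.Hypotheses.WeilClassesComponent (n+1) d f`), THEN the same holds on
EVERY component `(n, d, δ)`, `δ` arbitrary. AS PRINTED (`n = 2`): «Fix `f ∈ ℚ*/N_ℚ^K K*` with `sign(f) = -1` and a
Weil pair of rank `6`, `(V_ℤ, β)`, with invariant `(3, f)`. Suppose that for each Abelian variety in the associated
'universal' family, the Weil cohomology is generated by classes of codimension `3` algebraic cycles. Then the Weil
cohomology of `A`, `W_A`, is generated by classes of codimension `2` algebraic cycles.» READINGS NAMED: the typed
hypothesis quantifies over the whole CLASS `(n+1, d, f)` (⊇ the universal family of one Weil pair; it contains the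
polarized product `A × A′` itself, so Schoen's isogeny step ¶¶6–7 = the tree's NAMED reach fact is not used) — hypothesis
typed STRONGER, theorem typed WEAKER-OR-EQUAL than print; typed for all `n ≥ 1` ⊇ printed `n = 2`. Proof = Schoen's:
partner `A′ = S` in the class `f′ = f·δ` (§2), the hypothesis at the product, «`W_{A′}` is generated by cohomology
classes of divisors» = Lefschetz `(1,1)` on `S` (`lefschetzOneOne_rational_holds`) for a non-zero rational class
`u₊ + u₋` of its Weil plane, and the transfer `pr_{A*}(z · (A × D))`
(`Schoen1998_weilClasses_algebraic_of_prod_surface_all_of_weilClass_algebraic`, proved in every even dimension).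
[cite: Schoen1998HodgeWeilAddendum, 10 (Proposition), p. 332, proof pp. 332–333]
[cite: Markman2025SecantWeil, Cor. 1.6.1 (proof, p. 9)] [cite: VoisinHodgeI2002, Thm. 11.30]
[cite: vanGeemen1994HodgeAV, Lemma 5.2 (4)–(6) and 5.3] -/
theorem weilClassesComponent_of_component_succ {n d : ℕ} (hn : 0 < n) (hd : 0 < d)
    {f : weilNormResidueGroup d} (hf : weilSign d f = (-1) ^ (n + 1))
    (h : WeilClassesComponent (n + 1) d f) (δ : weilNormResidueGroup d) :
    WeilClassesComponent n d δ := by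
  intro A φ hA _hX hφ e a ha ha0 hδA c hc hcH hcW
  -- the zero class is algebraic; a non-zero rational `(n,n)` Weil class makes `(A, φ)` of Weil type `(n, d)`
  by_cases hc0 : c = 0
  · rw [hc0]; exact Submodule.zero_mem _
  have hW : IsWeilType A φ n d := isWeilType_of_weilClass_ne_zero hn hd hA hφ hcW hc0 hcH
  -- Schoen's partner surface in the class `f′ = f·δ` and the product, a member of `(n+1, d, f)`
  obtain ⟨E₀, ψ₀, S, ψ, eS, aS, e', a', -, -, -, hWS, -, -, -, ha', ha'0, hN'⟩ :=
    exists_cmProductPoint_partner_prod_mem_component hW e ha ha0 hδA hf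
  have hWP := isWeilType_prod hW hWS
  -- the hypothesis at the product: every rational `(n+1,n+1)` Weil class of `(A × S, φ × ψ)` is algebraic
  have hB : ∀ c' : complexBetti (A.prod S).X (2 * (n + 1)), IsRationalClass c' →
      IsOfHodgeType (2 * (n + 1)) (A.prod S).X (2 * (n + 1)) (n + 1) (n + 1) c' →
        c' ∈ weilClassesOf (A.prod S)
          (AbelianVariety.prodLift (AbelianVariety.fst A S ≫ φ) (AbelianVariety.snd A S ≫ ψ)) (n + 1) d →
        c' ∈ algebraicClasses (A.prod S).X (n + 1) :=
    fun c' hc' hc'H hc'W ↦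
      h (A.prod S) _ hWP.dim_eq hWP.isSmoothProjective hWP.sq_eq e' a' ha' ha'0 hN' c' hc' hc'H hc'W
  -- «`W_{A′}` is generated by cohomology classes of divisors»: a non-zero rational class `u = u₊ + u₋` of the
  -- partner's Weil plane is of type `(1,1)` (Weil type) and algebraic by Lefschetz `(1,1)`
  obtain ⟨u, huW, hu0, hur⟩ := exists_isRationalClass_ne_zero_mem_weilClassesOf one_pos hWS.dim_eq hd hWS.sq_eq
  have huH : IsOfHodgeType (2 * 1) S.X (2 * 1) 1 1 u := hWS.isOfHodgeType_of_mem_weilClassesOf huW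
  obtain ⟨up, hup, um, hum, rfl⟩ := Submodule.mem_sup.mp huW
  obtain ⟨hup0, hum0⟩ := ne_zero_of_isRationalClass_add one_pos hd hup hum hur hu0
  have huN : up + um ∈ algebraicClasses S.X 1 := lefschetzOneOne_rational_holds hWS.isSmoothProjective (up + um) hur huH
  -- Schoen's transfer: `W(A × A′)` algebraic ⟹ `W(A)` algebraic
  exact Schoen1998_weilClasses_algebraic_of_prod_surface_all_of_weilClass_algebraic hn hd φ ψ hW.isSmoothProjective
    (hWS.dim_eq.trans (by norm_num)) hWS.isSmoothProjective hWS.sq_eq hup hum hup0 hum0 hur huH huN hB hc hcH hcW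

/-- **AS PRINTED, `(n, n+1) = (2, 3)`: the Weil FOURFOLDS of `K_d` of EVERY class from ONE sixfold component of any class
`f` with `sign f = -1`.** [cite: Schoen1998HodgeWeilAddendum, 10 (Proposition), p. 332] -/
theorem weilClassesComponent_two_of_three {d : ℕ} (hd : 0 < d) {f : weilNormResidueGroup d}
    (hf : weilSign d f = -1) (h : WeilClassesComponent 3 d f) (δ : weilNormResidueGroup d) :
    WeilClassesComponent 2 d δ :=
  weilClassesComponent_of_component_succ two_pos hd (hf.trans (show (-1 : ℤˣ) = (-1) ^ (2 + 1 : ℕ) by decide)) h δ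

/-- **The S4-chain instance `(n, n+1) = (3, 4)`: every Weil SIXFOLD component `(3, d, δ)` of `K_d` is decided by ONE
eightfold component `(4, d, f)` of ANY class `f` with `sign f = 1`** (theory seat, bus l.10456 (ii): «at `n + 1 = 4` it
lets ONE eightfold component of ANY class decide every sixfold component»). [cite: Schoen1998HodgeWeilAddendum, 10 (Proposition), p. 332] -/
theorem weilClassesComponent_three_of_four {d : ℕ} (hd : 0 < d) {f : weilNormResidueGroup d}
    (hf : weilSign d f = 1) (h : WeilClassesComponent 4 d f) (δ : weilNormResidueGroup d) :
    WeilClassesComponent 3 d δ :=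
  weilClassesComponent_of_component_succ three_pos hd (hf.trans (show (1 : ℤˣ) = (-1) ^ (3 + 1 : ℕ) by decide)) h δ

/-- **(B2-L′) recovered as the instance `f = [(-1)ⁿ⁺¹]` (the SPLIT component one rung up), now for all `n ≥ 1`** — same
statement as `weilClassesComponent_of_split_component_succ` (there: `n ≥ 2`, kernel route `stub_descend`), here through
Schoen's class-agnostic Proposition. [cite: Markman2025SurveySecant, §11.5 Step 2 (p. 21)]
[cite: Schoen1998HodgeWeilAddendum, 10 (Proposition), p. 332] -/
theorem weilClassesComponent_of_split_component_succ' {n d : ℕ} (hn : 0 < n) (hd : 0 < d)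
    (h : WeilClassesComponent (n + 1) d (splitDiscriminantClass (n + 1) d)) (δ : weilNormResidueGroup d) :
    WeilClassesComponent n d δ :=
  weilClassesComponent_of_component_succ hn hd (weilSign_mk_neg_one_pow d (n + 1)) h δ

/-! ### §4 Component-free and uniform forms -/

/-- **Component-free form: ONE upper component of any admissible class gives `WeilAlgebraicAll n d`** — every rational
`(n,n)` Weil class on EVERY complex abelian `2n`-fold `(A, φ)` with `φ ≫ φ = -d` is algebraic (polarisation not in the
data). Every such `(A, φ)` carries SOME `K`-symmetrised hyperplane class with a non-degenerate discriminant class `δ`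
(van Geemen Lemma 5.2 (1)–(3), tree theorem `VanGeemen1994.exists_hasWeilDiscriminantNondeg`, for the hyperplane class of
any projective embedding, `SegreHyperplaneClass.exists_closedImmersion_projectiveSpace_pos`), and
`weilClassesComponent_of_component_succ` applies in that component. [cite: Schoen1998HodgeWeilAddendum, 10 (Proposition), p. 332]
[cite: vanGeemen1994HodgeAV, Lemma 5.2 (1)–(3)] -/
theorem weilAlgebraicAll_of_component_succ {n d : ℕ} (hn : 0 < n) (hd : 0 < d)
    {f : weilNormResidueGroup d} (hf : weilSign d f = (-1) ^ (n + 1))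
    (h : WeilClassesComponent (n + 1) d f) : WeilAlgebraicAll n d := by
  intro A φ hA hφ c hcW hc hcH
  -- a projective embedding of `A`, a non-zero rational hyperplane class, and the class `δ` of `(A, φ, h_K)`
  obtain ⟨N, ι, hN, hι⟩ := exists_closedImmersion_projectiveSpace_pos A
  obtain ⟨g, hgr, hgnz, -⟩ := exists_segreHyperplaneClasses
  let eA : ProjectiveEmbedding A.X := ⟨N, ι, hι⟩
  obtain ⟨δ, hδ⟩ := exists_hasWeilDiscriminantNondeg hn hA hd hφ eA (hgr N) (hgnz N hN)
  exact weilClassesComponent_of_component_succ hn hd hf h δ A φ hA (isSmoothProjective_of_dim_eq' hA) hφ eA (g N)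
    (hgr N) (hgnz N hN) hδ c hc hcH hcW

/-- **Uniform form: one upper component per `(n+1, d)`, of any admissible class, decides
`Ring2.Hypotheses.WeilClassesByComponent`** (every component, every `n ≥ 2`, every `d ≥ 1`, every `δ`).
[cite: Schoen1998HodgeWeilAddendum, 10 (Proposition), p. 332] [cite: Markman2025SurveySecant, §11.5 Step 2 (p. 21)] -/
theorem weilClassesByComponent_of_components_succ
    (h : ∀ (n : ℕ), 2 ≤ n → ∀ (d : ℕ), 0 < d →
      ∃ f : weilNormResidueGroup d, weilSign d f = (-1) ^ (n + 1) ∧ WeilClassesComponent (n + 1) d f) :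
    WeilClassesByComponent := by
  intro n hn d hd δ
  obtain ⟨f, hf, hF⟩ := h n hn d hd
  exact weilClassesComponent_of_component_succ (by omega) hd hf hF δ

/-! ### §5 Several rungs: ONE component of admissible class `k + 1` rungs up decides every component below

Appended (same seat): the Proposition ITERATED. At each intermediate rung the conclusion «every class» feeds the next
application (through the split class there, `weilSign_mk_neg_one_pow`), so ONE component `(n + k + 1, d, f)` of ANY class
`f` with `sign f = (-1)^{n+k+1}` decides EVERY component `(n, d, δ)` — for the S4 chain (S4-R1′, STRUCTURE §3.0 «THE
LADDER»): one TWELVEFOLD component `(6, K_d, f)`, `sign f = 1`, of any class decides every `K_d`-component of every rank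
`1 ≤ m ≤ 5`, in particular every Weil SIXFOLD component `(3, K_d, δ)`. Bookkeeping between OPEN typed class targets only.
-/

/-- **The Proposition iterated over `k + 1` rungs.** For `n ≥ 1`, `d ≥ 1`, `k ≥ 0` and a class `f` with
`sign f = (-1)^(n+k+1)`: `WeilClassesComponent (n + k + 1) d f` implies `WeilClassesComponent n d δ` for EVERY `δ`
(induction on `k`; the step descends from `(n + k + 2, d, f)` to the split class at rank `n + k + 1` and continues).
[cite: Schoen1998HodgeWeilAddendum, 10 (Proposition), p. 332] [cite: Markman2025SurveySecant, §11.5 Step 2 (p. 21)] -/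
theorem weilClassesComponent_of_component_add {n d : ℕ} (hn : 0 < n) (hd : 0 < d) (k : ℕ)
    {f : weilNormResidueGroup d} (hf : weilSign d f = (-1) ^ (n + k + 1))
    (h : WeilClassesComponent (n + k + 1) d f) (δ : weilNormResidueGroup d) :
    WeilClassesComponent n d δ := by
  induction k generalizing f δ with
  | zero => exact weilClassesComponent_of_component_succ hn hd hf h δ
  | succ k IH =>
    exact IH (weilSign_mk_neg_one_pow d (n + k + 1))
      (weilClassesComponent_of_component_succ (n := n + k + 1) (by omega) hd hf h _) δ

/-- **S4 instance: ONE Weil TWELVEFOLD component `(6, d, f)` of ANY class `f` with `sign f = 1` decides every Weil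
SIXFOLD component `(3, d, δ)`** (three rungs: `12 → 10 → 8 → 6`-folds; the (S4) rung of the cell's tables deciding the
`g = 6` rows by LADDER, S4-R1′). [cite: Schoen1998HodgeWeilAddendum, 10 (Proposition), p. 332] -/
theorem weilClassesComponent_three_of_six {d : ℕ} (hd : 0 < d) {f : weilNormResidueGroup d}
    (hf : weilSign d f = 1) (h : WeilClassesComponent 6 d f) (δ : weilNormResidueGroup d) :
    WeilClassesComponent 3 d δ :=
  weilClassesComponent_of_component_add three_pos hd 2 (hf.trans (show (1 : ℤˣ) = (-1) ^ (3 + 2 + 1 : ℕ) by decide)) h δ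

/-- **… and every component of every rank `1 ≤ m ≤ 5`** (`m + (5 - m) + 1 = 6`).
[cite: Schoen1998HodgeWeilAddendum, 10 (Proposition), p. 332] -/
theorem weilClassesComponent_of_six {d m : ℕ} (hm : 0 < m) (hm5 : m ≤ 5) (hd : 0 < d) {f : weilNormResidueGroup d}
    (hf : weilSign d f = 1) (h : WeilClassesComponent 6 d f) (δ : weilNormResidueGroup d) :
    WeilClassesComponent m d δ := by
  have h6 : m + (5 - m) + 1 = 6 := by omega
  refine weilClassesComponent_of_component_add hm hd (5 - m) (f := f) ?_ (h6 ▸ h) δ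
  rw [hf, h6]; decide

end Summit.Ventures.HSemireg

end
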